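import Mathlib
import Summits.RiemannHypothesis.RiemannHypothesis.Theorems.DensityLadderSeparatedTowerGaussian
import HarnessLib

/-!
# `DensityLadder.SeparatedTowerDensityLine` (item stmt-RiemannHypothesis-24918) — pointwise majorant
# and tame mean square for the UPPER half of stub S1

LINE L57 «sieve sight above the density line» (rh-idea-10 g1), crux K1 `SeparatedTowerDensityLine`,
stub S1 (assembly skeleton `S1-ASSEMBLY-SKELETON.lean` on stmt-RiemannHypothesis-24918).  Two
self-contained pieces of the mean-square upper bound `∫ |Z_F|² G ≪ A² log² A`:
* `pointwise_majorant`: from the explicit-formula bound `‖S(x)‖ ≤ C_a(x log x + A log x)` (`x ≥ 3`)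
  and the decomposition `S(e^u) = Z_F(u) + Z_A(u) + (far tail)`,
  `‖Z_F(u)‖² ≤ 6C_a²(u²e^{2u} + A²u²) + 3‖Z_A(u)‖² + 3e^{2u}C_R² + (3S₁)²` for every real `u`
  (the last term covers `u ≤ log 3`, where `‖e^{ρu}‖ ≤ 3`).
* `tame_meanSquare_le`: `∫ ‖Z_A‖² G_L(u−U) du ≤ √(2π) L e^{U+L²/2} · 4S₃ · S₂` from the finite
  mean-square expansion (`integral_normSq_sum_mul_gaussian`), `0 ≤ Re ρ ≤ 1/2` on the tame part,
  `‖ĉ‖ ≤ 4`, and a Schur bound `S₃` for the Gaussian kernel `e^{−(L²/2)(γ_j−γ_i)²}`.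
Cell rh-split, seat rh-split-prover-l57 g0.  RH-free, ζ-free; FRONTIER bookkeeping; nothing here
bears on the truth of RH.
-/

set_option linter.dupNamespace false
set_option maxHeartbeats 1600000

noncomputable section

open Complex Filter Set MeasureTheory Topology Finset
open scoped Real ComplexConjugate

namespace Summit.RiemannHypothesis.RiemannHypothesis.Theorems.DensityLadderSeparatedTowerUpperPointwise

open Summit.RiemannHypothesis.RiemannHypothesis.Theorems.DensityLadderSeparatedTowerGaussian

/-- `(e^u)^ρ = e^{ρu}` for real `u` (principal branch). [folklore] -/
theorem exp_cpow_eq (u : ℝ) (ρ : ℂ) : ((Real.exp u : ℝ) : ℂ) ^ ρ = cexp (ρ * u) := by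
  rw [Complex.ofReal_exp, Complex.cpow_def_of_ne_zero (Complex.exp_ne_zero _), Complex.log_exp]
  · ring_nf
  · simp [Real.pi_pos]
  · simp [Real.pi_pos.le]

/-- `‖e^{ρu}‖ ≤ 3` for `u ≤ log 3` and `0 ≤ Re ρ ≤ 1`. [folklore] -/
theorem norm_cexp_le_three {u : ℝ} (hu : u ≤ Real.log 3) {ρ : ℂ} (h0 : 0 ≤ ρ.re) (h1 : ρ.re ≤ 1) :
    ‖cexp (ρ * u)‖ ≤ 3 := by
  rw [Complex.norm_exp]
  have hre : (ρ * (u : ℂ)).re = ρ.re * u := by simp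
  rw [hre]
  rcases le_or_gt u 0 with hu0 | hu0
  · calc Real.exp (ρ.re * u) ≤ Real.exp 0 := Real.exp_le_exp.2 (by nlinarith)
      _ = 1 := Real.exp_zero
      _ ≤ 3 := by norm_num
  · calc Real.exp (ρ.re * u) ≤ Real.exp u := Real.exp_le_exp.2 (by nlinarith)
      _ ≤ Real.exp (Real.log 3) := Real.exp_le_exp.2 hu
      _ = 3 := Real.exp_log (by norm_num)

/-- **Pointwise majorant of the truncated tower sum** (see the module docstring). [folklore] -/
theorem pointwise_majorant {ι : Type} (m : ι → ℝ) (ρ : ι → ℂ) (c : ι → ℂ) (hm0 : ∀ i, 0 ≤ m i)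
    (hre01 : ∀ i, 0 ≤ (ρ i).re ∧ (ρ i).re ≤ 1) {A Ca CR S1 R : ℝ}
    (F Atm : Finset ι) (hdisj : Disjoint F Atm) (hcover : ∀ i, i ∉ F → i ∉ Atm → R < |(ρ i).im|)
    (hs1 : ∑ i ∈ F, m i * ‖c i‖ ≤ S1)
    (hfarS : Summable (fun i : ι ↦ if R < |(ρ i).im| then m i * ‖c i‖ else 0))
    (hfar : (∑' i : ι, if R < |(ρ i).im| then m i * ‖c i‖ else 0) ≤ CR)
    (hS : ∀ x : ℝ, 3 ≤ x →
      ‖∑' i : ι, (m i : ℂ) * ((x : ℂ) ^ (ρ i) * c i)‖ ≤ Ca * (x * Real.log x + A * Real.log x))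
    (hSum : ∀ x : ℝ, 3 ≤ x → Summable (fun i : ι ↦ m i * ‖(x : ℂ) ^ (ρ i) * c i‖)) (u : ℝ) :
    ‖∑ i ∈ F, (m i : ℂ) * c i * cexp (ρ i * u)‖ ^ 2 ≤
      6 * Ca ^ 2 * (u ^ 2 * Real.exp (2 * u) + A ^ 2 * u ^ 2) +
        3 * ‖∑ i ∈ Atm, (m i : ℂ) * c i * cexp (ρ i * u)‖ ^ 2 + 3 * (Real.exp (2 * u) * CR ^ 2) +
        (3 * S1) ^ 2 := by
  classical
  set Z : ℝ → ℂ := fun u ↦ ∑ i ∈ F, (m i : ℂ) * c i * cexp (ρ i * u) with hZ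
  set ZA : ℝ → ℂ := fun u ↦ ∑ i ∈ Atm, (m i : ℂ) * c i * cexp (ρ i * u) with hZA
  set Z₀ : ℝ := 3 * S1 with hZ₀
  show ‖Z u‖ ^ 2 ≤ 6 * Ca ^ 2 * (u ^ 2 * Real.exp (2 * u) + A ^ 2 * u ^ 2) + 3 * ‖ZA u‖ ^ 2 +
    3 * (Real.exp (2 * u) * CR ^ 2) + Z₀ ^ 2
  -- small `u`
  have hsmall : ∀ u : ℝ, u ≤ Real.log 3 → ‖Z u‖ ≤ Z₀ := by
    intro u hu
    calc ‖Z u‖ ≤ ∑ i ∈ F, ‖(m i : ℂ) * c i * cexp (ρ i * u)‖ := norm_sum_le _ _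
      _ ≤ ∑ i ∈ F, m i * ‖c i‖ * 3 := Finset.sum_le_sum fun i _ ↦ by
          rw [norm_mul, norm_mul, Complex.norm_real, Real.norm_of_nonneg (hm0 i)]
          exact mul_le_mul_of_nonneg_left (norm_cexp_le_three hu (hre01 i).1 (hre01 i).2)
            (mul_nonneg (hm0 i) (norm_nonneg _))
      _ = 3 * ∑ i ∈ F, m i * ‖c i‖ := by rw [Finset.mul_sum]; exact Finset.sum_congr rfl fun i _ ↦ by ring
      _ ≤ Z₀ := by rw [hZ₀]; exact mul_le_mul_of_nonneg_left hs1 (by norm_num)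
  -- large `u`: the decomposition of the full zero sum
  have hlarge : ∀ u : ℝ, Real.log 3 ≤ u →
      ‖Z u‖ ≤ Ca * (Real.exp u * u + A * u) + ‖ZA u‖ + Real.exp u * CR := by
    intro u hu
    set x : ℝ := Real.exp u with hx
    have hx3 : 3 ≤ x := by
      rw [hx, ← Real.exp_log (by norm_num : (0 : ℝ) < 3)]; exact Real.exp_le_exp.2 hu
    have hx1 : 1 ≤ x := by linarith
    have hx0 : 0 < x := by linarith
    have hlogx : Real.log x = u := by rw [hx, Real.log_exp]
    -- the summands
    set f : ι → ℂ := fun i ↦ (m i : ℂ) * ((x : ℂ) ^ (ρ i) * c i) with hf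
    have hfs : Summable f := by
      have h := hSum x hx3
      refine Summable.of_norm (h.congr fun i ↦ ?_)
      rw [hf]; simp only [norm_mul, Complex.norm_real, Real.norm_eq_abs, abs_of_nonneg (hm0 i)]
    have hfterm : ∀ i, f i = (m i : ℂ) * c i * cexp (ρ i * u) := by
      intro i
      rw [hf]; simp only
      rw [hx, exp_cpow_eq]; ring
    -- splitting off `F ∪ Atm`
    have hsplit := hfs.sum_add_tsum_compl (s := F ∪ Atm)
    have hSval : ∑' i, f i = Z u + ZA u + ∑' i : ↥((↑(F ∪ Atm) : Set ι)ᶜ), f i := by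
      rw [← hsplit, Finset.sum_union hdisj]
      simp only [hZ, hZA, hfterm]
    -- the tail
    have htail : ‖∑' i : ↥((↑(F ∪ Atm) : Set ι)ᶜ), f i‖ ≤ x * CR := by
      have hns : Summable fun i : ↥((↑(F ∪ Atm) : Set ι)ᶜ) ↦ ‖f i‖ := (hfs.norm).subtype _
      refine (norm_tsum_le_tsum_norm hns).trans ?_
      rw [tsum_subtype ((↑(F ∪ Atm) : Set ι)ᶜ) (fun i ↦ ‖f i‖)]
      have hle : ∀ i, ((↑(F ∪ Atm) : Set ι)ᶜ).indicator (fun i ↦ ‖f i‖) i ≤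
          x * (if R < |(ρ i).im| then m i * ‖c i‖ else 0) := by
        intro i
        by_cases hi : i ∈ ((↑(F ∪ Atm) : Set ι)ᶜ)
        · rw [Set.indicator_of_mem hi]
          have hfar_i : R < |(ρ i).im| := by
            rw [Set.mem_compl_iff, Finset.mem_coe, Finset.mem_union, not_or] at hi
            exact hcover i hi.1 hi.2
          rw [if_pos hfar_i, hf]; simp only
          rw [norm_mul, norm_mul, Complex.norm_real, Real.norm_of_nonneg (hm0 i),
            Complex.norm_cpow_eq_rpow_re_of_pos hx0]
          have hxpow : x ^ (ρ i).re ≤ x := by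
            calc x ^ (ρ i).re ≤ x ^ (1 : ℝ) := Real.rpow_le_rpow_of_exponent_le hx1 (hre01 i).2
              _ = x := Real.rpow_one x
          calc m i * (x ^ (ρ i).re * ‖c i‖) ≤ m i * (x * ‖c i‖) := by
                exact mul_le_mul_of_nonneg_left (mul_le_mul_of_nonneg_right hxpow (norm_nonneg _)) (hm0 i)
            _ = x * (m i * ‖c i‖) := by ring
        · rw [Set.indicator_of_notMem hi]
          split_ifs
          · exact mul_nonneg hx0.le (mul_nonneg (hm0 i) (norm_nonneg _))
          · simp
      have hsi : Summable (((↑(F ∪ Atm) : Set ι)ᶜ).indicator (fun i ↦ ‖f i‖)) :=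
        (hfs.norm).indicator _
      calc ∑' i, ((↑(F ∪ Atm) : Set ι)ᶜ).indicator (fun i ↦ ‖f i‖) i
          ≤ ∑' i, x * (if R < |(ρ i).im| then m i * ‖c i‖ else 0) :=
            hsi.tsum_le_tsum hle (hfarS.mul_left x)
        _ = x * ∑' i, (if R < |(ρ i).im| then m i * ‖c i‖ else 0) := tsum_mul_left
        _ ≤ x * CR := mul_le_mul_of_nonneg_left hfar hx0.le
    -- the full sum
    have hSx' : ‖∑' i, f i‖ ≤ Ca * (x * u + A * u) := by
      have h := hS x hx3
      rw [hlogx] at h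
      exact h
    -- combine
    have hZeq : Z u = ∑' i, f i - ZA u - ∑' i : ↥((↑(F ∪ Atm) : Set ι)ᶜ), f i := by
      rw [hSval]; ring
    calc ‖Z u‖ = ‖∑' i, f i - ZA u - ∑' i : ↥((↑(F ∪ Atm) : Set ι)ᶜ), f i‖ := by rw [hZeq]
      _ ≤ ‖∑' i, f i‖ + ‖ZA u‖ + ‖∑' i : ↥((↑(F ∪ Atm) : Set ι)ᶜ), f i‖ := by
          have h1 := norm_sub_le (∑' i, f i - ZA u) (∑' i : ↥((↑(F ∪ Atm) : Set ι)ᶜ), f i)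
          have h2 := norm_sub_le (∑' i, f i) (ZA u)
          linarith only [h1, h2]
      _ ≤ Ca * (x * u + A * u) + ‖ZA u‖ + x * CR := by linarith only [htail, hSx']
      _ = Ca * (Real.exp u * u + A * u) + ‖ZA u‖ + Real.exp u * CR := by rw [hx]
  -- combine into the majorant
  have hpt : ‖Z u‖ ^ 2 ≤ 6 * Ca ^ 2 * (u ^ 2 * Real.exp (2 * u) + A ^ 2 * u ^ 2) + 3 * ‖ZA u‖ ^ 2 +
      3 * (Real.exp (2 * u) * CR ^ 2) + Z₀ ^ 2 := by
    have hZA0 : 0 ≤ ‖ZA u‖ := norm_nonneg _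
    have he0 : 0 ≤ Real.exp (2 * u) := (Real.exp_pos _).le
    rcases le_or_gt u (Real.log 3) with hu | hu
    · have h := hsmall u hu
      have : ‖Z u‖ ^ 2 ≤ Z₀ ^ 2 := pow_le_pow_left₀ (norm_nonneg _) h 2
      have p1 : 0 ≤ 6 * Ca ^ 2 * (u ^ 2 * Real.exp (2 * u) + A ^ 2 * u ^ 2) := by positivity
      have p2 : 0 ≤ 3 * ‖ZA u‖ ^ 2 := by positivity
      have p3 : 0 ≤ 3 * (Real.exp (2 * u) * CR ^ 2) := by positivity
      linarith only [this, p1, p2, p3]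
    · have h := hlarge u hu.le
      have hZ0 : 0 ≤ ‖Z u‖ := norm_nonneg _
      have hsq := pow_le_pow_left₀ hZ0 h 2
      have he2 : Real.exp (2 * u) = Real.exp u ^ 2 := by rw [← Real.exp_nat_mul]; ring_nf
      have h3 : ∀ a b d : ℝ, (a + b + d) ^ 2 ≤ 3 * (a ^ 2 + b ^ 2 + d ^ 2) := fun a b d ↦ by
        nlinarith only [sq_nonneg (a - b), sq_nonneg (b - d), sq_nonneg (a - d)]
      have h3 := h3 (Ca * (Real.exp u * u + A * u)) ‖ZA u‖ (Real.exp u * CR)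
      have h4 : (Ca * (Real.exp u * u + A * u)) ^ 2 ≤ 2 * Ca ^ 2 * (u ^ 2 * Real.exp (2 * u) + A ^ 2 * u ^ 2) := by
        have : ∀ p q : ℝ, (p + q) ^ 2 ≤ 2 * (p ^ 2 + q ^ 2) := fun p q ↦ by
          nlinarith only [sq_nonneg (p - q)]
        have := this (Real.exp u * u) (A * u)
        rw [mul_pow, he2]
        calc Ca ^ 2 * (Real.exp u * u + A * u) ^ 2 ≤ Ca ^ 2 * (2 * ((Real.exp u * u) ^ 2 + (A * u) ^ 2)) :=
              mul_le_mul_of_nonneg_left this (sq_nonneg _)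
          _ = 2 * Ca ^ 2 * (u ^ 2 * Real.exp u ^ 2 + A ^ 2 * u ^ 2) := by ring
      have h5 : (Real.exp u * CR) ^ 2 = Real.exp (2 * u) * CR ^ 2 := by rw [mul_pow, he2]
      rw [h5] at h3
      have p4 : 0 ≤ Z₀ ^ 2 := sq_nonneg _
      linarith only [h3, h4, hsq, p4]
  exact hpt

/-- **Tame mean square** (see the module docstring). [folklore] -/
theorem tame_meanSquare_le {ι : Type} (m : ι → ℝ) (ρ : ι → ℂ) (c : ι → ℂ) (hm0 : ∀ i, 0 ≤ m i)
    (Atm : Finset ι) (hAtame : ∀ i ∈ Atm, (ρ i).re ≤ 1 / 2) (hre0 : ∀ i, 0 ≤ (ρ i).re)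
    (hc4 : ∀ i, ‖c i‖ ≤ 4) {L U S2 S3 : ℝ} (hL0 : 0 < L) (hU0 : 0 ≤ U)
    (hs2 : ∑ i ∈ Atm, m i * ‖c i‖ ≤ S2) (hS3 : 0 ≤ S3)
    (hs3 : ∀ i ∈ Atm, ∑ j ∈ Atm, m j * Real.exp (-(L ^ 2 / 2 * ((ρ j).im - (ρ i).im) ^ 2)) ≤ S3) :
    ∫ u : ℝ, ‖∑ i ∈ Atm, (m i : ℂ) * c i * cexp (ρ i * u)‖ ^ 2 *
        Real.exp (-(u - U) ^ 2 / (2 * L ^ 2)) ≤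
      Real.sqrt (2 * π) * L * Real.exp (U + L ^ 2 / 2) * (4 * S3) * S2 := by
  classical
  set c₀ : ℝ := Real.sqrt (2 * π) * L with hc₀
  have hc₀0 : 0 < c₀ := by positivity
  set ZA : ℝ → ℂ := fun u ↦ ∑ i ∈ Atm, (m i : ℂ) * c i * cexp (ρ i * u) with hZA
  set G : ℝ → ℝ := fun u ↦ Real.exp (-(u - U) ^ 2 / (2 * L ^ 2)) with hG
  have hgoal : (∫ u : ℝ, ‖∑ i ∈ Atm, (m i : ℂ) * c i * cexp (ρ i * u)‖ ^ 2 *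
      Real.exp (-(u - U) ^ 2 / (2 * L ^ 2))) = ∫ u, ‖ZA u‖ ^ 2 * G u := rfl
  rw [hgoal]
  set b : ι → ℂ := fun i ↦ (m i : ℂ) * c i with hb
  have hJ := integral_normSq_sum_mul_gaussian Atm b ρ hL0 U
  have hprod : (∫ u : ℝ, (((‖∑ i ∈ Atm, b i * cexp (ρ i * u)‖ ^ 2 : ℝ) : ℂ)) *
      (Real.exp (-(u - U) ^ 2 / (2 * L ^ 2)) : ℂ)) =
      ((∫ u : ℝ, ‖ZA u‖ ^ 2 * G u : ℝ) : ℂ) := by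
    rw [← integral_complex_ofReal]
    refine integral_congr_ae (Eventually.of_forall fun u ↦ ?_)
    simp only [hZA, hG, hb]
    push_cast; ring
  have hre : ∫ u, ‖ZA u‖ ^ 2 * G u = (∑ i ∈ Atm, ∑ j ∈ Atm, b i * conj (b j) *
      (((Real.sqrt (2 * π) * L : ℝ) : ℂ) * cexp ((ρ i + conj (ρ j)) * U + (ρ i + conj (ρ j)) ^ 2 * L ^ 2 / 2))).re := by
    rw [← hJ, hprod, Complex.ofReal_re]
  rw [hre]
  refine (Complex.re_le_norm _).trans ?_
  refine (norm_sum_le _ _).trans ?_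
  have hzform : ∀ i j, ρ i + conj (ρ j) =
      (((((ρ i).re + (ρ j).re : ℝ)) : ℂ) + (((ρ i).im - (ρ j).im : ℝ) : ℂ) * I) := fun i j ↦ by
    apply Complex.ext <;> (simp; try ring)
  have hterm : ∀ i ∈ Atm, ∀ j ∈ Atm, ‖b i * conj (b j) *
      (((Real.sqrt (2 * π) * L : ℝ) : ℂ) * cexp ((ρ i + conj (ρ j)) * U + (ρ i + conj (ρ j)) ^ 2 * L ^ 2 / 2))‖ ≤
      c₀ * Real.exp (U + L ^ 2 / 2) * ((m i * ‖c i‖) * (4 * m j *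
        Real.exp (-(L ^ 2 / 2 * ((ρ j).im - (ρ i).im) ^ 2)))) := by
    intro i hi j hj
    have hβi := (hAtame i hi); have hβj := (hAtame j hj)
    have h0i := hre0 i; have h0j := hre0 j
    rw [hzform i j]
    have hg' := norm_cexp_gaussMV_offDiag_le ((ρ i).re) ((ρ j).re) ((ρ i).im - (ρ j).im) U L
    have hexp : Real.exp ((ρ i).re * U + (ρ i).re ^ 2 * L ^ 2) * Real.exp ((ρ j).re * U + (ρ j).re ^ 2 * L ^ 2) *
        Real.exp (-(((ρ i).im - (ρ j).im) ^ 2 * L ^ 2 / 2)) ≤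
        Real.exp (U + L ^ 2 / 2) * Real.exp (-(L ^ 2 / 2 * ((ρ j).im - (ρ i).im) ^ 2)) := by
      rw [← Real.exp_add, ← Real.exp_add, ← Real.exp_add, Real.exp_le_exp]
      have hL2 : 0 ≤ L ^ 2 := sq_nonneg L
      have h1 : (ρ i).re * U ≤ 1 / 2 * U := mul_le_mul_of_nonneg_right hβi hU0
      have h2 : (ρ j).re * U ≤ 1 / 2 * U := mul_le_mul_of_nonneg_right hβj hU0
      have h3i : (ρ i).re ^ 2 ≤ 1 / 4 := by nlinarith only [hβi, h0i]
      have h3j : (ρ j).re ^ 2 ≤ 1 / 4 := by nlinarith only [hβj, h0j]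
      have h3 : (ρ i).re ^ 2 * L ^ 2 ≤ 1 / 4 * L ^ 2 := mul_le_mul_of_nonneg_right h3i hL2
      have h4 : (ρ j).re ^ 2 * L ^ 2 ≤ 1 / 4 * L ^ 2 := mul_le_mul_of_nonneg_right h3j hL2
      have h5 : -(((ρ i).im - (ρ j).im) ^ 2 * L ^ 2 / 2) = -(L ^ 2 / 2 * ((ρ j).im - (ρ i).im) ^ 2) := by
        ring
      linarith only [h1, h2, h3, h4, h5]
    have hE := hg'.trans hexp
    have hcj : m j * ‖c j‖ ≤ m j * 4 := mul_le_mul_of_nonneg_left (hc4 j) (hm0 j)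
    have hnorm : ‖b i * conj (b j) * (((Real.sqrt (2 * π) * L : ℝ) : ℂ) *
        cexp ((((((ρ i).re + (ρ j).re : ℝ)) : ℂ) + (((ρ i).im - (ρ j).im : ℝ) : ℂ) * I) * U +
          (((((ρ i).re + (ρ j).re : ℝ)) : ℂ) + (((ρ i).im - (ρ j).im : ℝ) : ℂ) * I) ^ 2 * (L : ℂ) ^ 2 / 2))‖ =
        (m i * ‖c i‖) * (m j * ‖c j‖) * (c₀ * ‖cexp ((((((ρ i).re + (ρ j).re : ℝ)) : ℂ) +
          (((ρ i).im - (ρ j).im : ℝ) : ℂ) * I) * U +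
          (((((ρ i).re + (ρ j).re : ℝ)) : ℂ) + (((ρ i).im - (ρ j).im : ℝ) : ℂ) * I) ^ 2 * (L : ℂ) ^ 2 / 2)‖) := by
      rw [hb]
      simp only [norm_mul, Complex.norm_conj, Complex.norm_real, Real.norm_eq_abs, abs_of_nonneg (hm0 i),
        abs_of_nonneg (hm0 j), abs_of_nonneg (Real.sqrt_nonneg (2 * π)), abs_of_pos hL0, hc₀]
    rw [hnorm]
    have hmci : 0 ≤ m i * ‖c i‖ := mul_nonneg (hm0 i) (norm_nonneg _)
    calc (m i * ‖c i‖) * (m j * ‖c j‖) * (c₀ * ‖cexp ((((((ρ i).re + (ρ j).re : ℝ)) : ℂ) +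
          (((ρ i).im - (ρ j).im : ℝ) : ℂ) * I) * U +
          (((((ρ i).re + (ρ j).re : ℝ)) : ℂ) + (((ρ i).im - (ρ j).im : ℝ) : ℂ) * I) ^ 2 * (L : ℂ) ^ 2 / 2)‖)
        ≤ (m i * ‖c i‖) * (m j * 4) * (c₀ * (Real.exp (U + L ^ 2 / 2) *
            Real.exp (-(L ^ 2 / 2 * ((ρ j).im - (ρ i).im) ^ 2)))) := by
          have hmj4 : 0 ≤ m i * ‖c i‖ * (m j * 4) :=
            mul_nonneg hmci (mul_nonneg (hm0 j) (by norm_num))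
          exact mul_le_mul (mul_le_mul_of_nonneg_left hcj hmci)
            (mul_le_mul_of_nonneg_left hE hc₀0.le) (mul_nonneg hc₀0.le (norm_nonneg _)) hmj4
      _ = _ := by ring
  calc ∑ i ∈ Atm, ‖∑ j ∈ Atm, b i * conj (b j) *
        (((Real.sqrt (2 * π) * L : ℝ) : ℂ) * cexp ((ρ i + conj (ρ j)) * U + (ρ i + conj (ρ j)) ^ 2 * L ^ 2 / 2))‖
      ≤ ∑ i ∈ Atm, ∑ j ∈ Atm, c₀ * Real.exp (U + L ^ 2 / 2) * ((m i * ‖c i‖) * (4 * m j *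
          Real.exp (-(L ^ 2 / 2 * ((ρ j).im - (ρ i).im) ^ 2)))) :=
        Finset.sum_le_sum fun i hi ↦ (norm_sum_le _ _).trans (Finset.sum_le_sum fun j hj ↦ hterm i hi j hj)
    _ = c₀ * Real.exp (U + L ^ 2 / 2) * ∑ i ∈ Atm, (m i * ‖c i‖) *
          (4 * ∑ j ∈ Atm, m j * Real.exp (-(L ^ 2 / 2 * ((ρ j).im - (ρ i).im) ^ 2))) := by
        rw [Finset.mul_sum]
        refine Finset.sum_congr rfl fun i _ ↦ ?_
        rw [Finset.mul_sum, Finset.mul_sum, Finset.mul_sum]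
        refine Finset.sum_congr rfl fun j _ ↦ ?_
        ring
    _ ≤ c₀ * Real.exp (U + L ^ 2 / 2) * ∑ i ∈ Atm, (m i * ‖c i‖) * (4 * S3) := by
        refine mul_le_mul_of_nonneg_left ?_ (by positivity)
        exact Finset.sum_le_sum fun i hi ↦ mul_le_mul_of_nonneg_left
          (mul_le_mul_of_nonneg_left (hs3 i hi) (by norm_num)) (mul_nonneg (hm0 i) (norm_nonneg _))
    _ = c₀ * Real.exp (U + L ^ 2 / 2) * (4 * S3) * ∑ i ∈ Atm, m i * ‖c i‖ := by
        rw [← Finset.sum_mul]; ring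
    _ ≤ c₀ * Real.exp (U + L ^ 2 / 2) * (4 * S3) * S2 :=
        mul_le_mul_of_nonneg_left hs2 (by positivity)

end Summit.RiemannHypothesis.RiemannHypothesis.Theorems.DensityLadderSeparatedTowerUpperPointwise

end
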